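import Summits.BirchSwinnertonDyer.BirchSwinnertonDyer.Theorems.ResidualThetaTransportAtTwoResidualSignedLambdaLowerCMAtTwoCofreeRegularAtInfinity
import Literature.NumberTheory.GaloisCohomology.CupProductShapiroReciprocityCore
import HarnessLib

/-!
# Levelwise reciprocity core (EH) for the CM partner's torsion modules `A_ρ[N]`, EXACT on the habitat `Δ_W < 0`:
# `Σ_{v ∈ T} inv_v loc_v(Sh ψ₁ ∪ Sh ψ₂) = 0` for Shapiro lifts of classes dying on `U ⊓ I_𝔓` off `T`
# (helper toward crux RSL_g `ResidualSignedLambdaLowerCMAtTwo`, stmt-BirchSwinnertonDyer-22608; `--supports`, closes nothing)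

Route `ResidualThetaTransportAtTwo` (RTT), crux RSL_g (lead `bsd-wall-rtt-p2`), STUB-PLAN `stub_cmLambdaLower` rev 16 §3.3¹⁰ item 5
(`stub_reciprocity`, EXACT form); width seat `bsd-wall-tp2-p2x-w2` g17. HONEST FRAMING: THEOREMS ONLY (no definition, no named fact, no
instance, no `sorry`); BSD is not proved by any of this; RSL_g and the K3 crux stay OPEN; the pins (the pairing `P`, the set `T`, the
classes `ψᵢ`) are PARAMETERS — this is the pin-free core the registered stub instantiates.

WHAT. `sum_localInvariantMap_cupProduct_shapiroLift_cofreeTorsion_eq_zero`: on the habitat of `ThetaTransport.residualIso` (`GoodSS W 2`,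
`Δ_W < 0`, congruent newform `g`, framed `ρ`, irreducible `ϖ`), for every open `U ≤ Γ_ℚ` of finite index with representatives `s`
(e.g. `U = Γ_{ℚ_n}`), every level `N = 2^r`, every pairing `P : Maps(Γ_ℚ ⧸ U, A_ρ[N])² → μ_N`, every finite set `T` of primes and all
cocycles `ψ₁, ψ₂ : U → A_ρ[N]` whose classes die on `U ⊓ I_𝔓` for all `𝔓` over all `v ∉ T`:
`Σ_{v ∈ T} inv_v loc_v(Sh ψ₁ ∪ Sh ψ₂) = 0` EXACTLY — the generic core
`GaloisCohomology.sum_localInvariantMap_cupProduct_shapiroLift_eq_zero_of_resLe_inertia` (Brauer sum, (U), (ShU), inertia bridge) with its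
archimedean hypothesis `hanti` DISCHARGED by S-A `cofreeTorsionGaloisModule_hanti_of_Δ_neg` (`…CofreeRegularAtInfinity`). The `T`-terms are
then read orbit by orbit in the layer-pairing currency (`CyclotomicLayer.invAt_localization_cupProduct_shapiroLift_eq_sum`, orbit
representatives from `exists_orbitReps_bijective`).

References: [MilneADT2006] Ch. I Thm. 2.6, 4.10 (b); [NeukirchSchmidtWingberg2008] I §6 (1.6.4), VIII §1; [Brown1982] VI §8; [GreenbergLNM1716] §3.
-/

set_option autoImplicit false
-- the Theorems namespace of this sub repeats the summit name by design (D-0017 nested layout)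
set_option linter.dupNamespace false

noncomputable section

open scoped Classical MatrixGroups NumberField

open Matrix WeierstrassCurve NumberField Field IsDedekindDomain CategoryTheory
  Literature.NumberTheory.EllipticCurves Literature.NumberTheory.EllipticCurves.DokchitserDokchitser2012
  Literature.NumberTheory.GaloisRepresentations Literature.NumberTheory.EllipticCurves.Rank1Residual
  Literature.NumberTheory.EllipticCurves.GreenbergSelmer Rat.HeightOneSpectrum
  Literature.NumberTheory.GaloisCohomology Literature.NumberTheory.GaloisRepresentations.DiscreteGaloisModule
  _root_.ContinuousCohomology _root_.TopRep

namespace Summit.BirchSwinnertonDyer.BirchSwinnertonDyer.Theorems.ThetaTransport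

/-- **Levelwise reciprocity core for `A_ρ[N]`, exact on the habitat.** For the residualIso habitat and `c`-regular torsion modules
(S-A), every open `U ≤ Γ_ℚ` of finite index with representatives `s`, `N = 2^r`, a pairing `P` on the coinduced modules with values
in `μ_N`, a finite set `T` of primes and cocycles `ψ₁, ψ₂ : U → A_ρ[N]` whose classes die on `U ⊓ I_𝔓` off `T`:
`Σ_{v ∈ T} inv_v loc_v(Sh ψ₁ ∪ Sh ψ₂) = 0`. [cite: MilneADT2006, Ch. I, Thm. 2.6 and Thm. 4.10(b)]
[cite: NeukirchSchmidtWingberg2008, I §6 Prop. (1.6.4)] [cite: Brown1982, VI §8] -/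
theorem sum_localInvariantMap_cupProduct_shapiroLift_cofreeTorsion_eq_zero (W : WeierstrassCurve ℚ) [W.IsElliptic]
    [W.IsGloballyMinimal] (hss : GoodSS W 2) (hΔ : W.Δ < 0) {M : ℕ} [NeZero M] (g : CuspForm (CongruenceSubgroup.Gamma0 M) 2)
    (ι : ModularForms.coeffField g →+* PadicAlgCl 2) (hnew : ModularForms.IsNewform0 g)
    (hcong : ∀ ℓ : ℕ, ℓ.Prime → ¬ ℓ ∣ 2 * M * W.conductorNorm ℤ →
      ‖embCoeff g ι ℓ - (W.frobeniusTrace ℓ : PadicAlgCl 2)‖ < 1)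
    (ρ : FramedGaloisRep ℚ ↥(padicCoeffIntegers (Set.range ι)) 2)
    (hρ : ∀ v : HeightOneSpectrum (𝓞 ℚ), ¬ natGenerator v ∣ 2 * M →
      FramedGaloisRep.IsUnramifiedAt v ρ ∧ ∃ P : Polynomial ↥(padicCoeffIntegers (Set.range ι)),
        P.map (padicCoeffIntegers (Set.range ι)).subtype =
          Polynomial.X ^ 2 - Polynomial.C (embCoeff g ι (natGenerator v)) * Polynomial.X +
            Polynomial.C ((natGenerator v : ℕ) : PadicAlgCl 2) ∧
        FramedGaloisRep.HasFrobCharpolyAt v P ρ)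
    (ϖ : ↥(padicCoeffIntegers (Set.range ι))) (hϖ : Irreducible ϖ)
    (U : Subgroup (absoluteGaloisGroup ℚ)) (hU : IsOpen (U : Set (absoluteGaloisGroup ℚ)))
    [Fintype (absoluteGaloisGroup ℚ ⧸ U)]
    {s : absoluteGaloisGroup ℚ ⧸ U → absoluteGaloisGroup ℚ} (hs : ∀ x, (s x : absoluteGaloisGroup ℚ ⧸ U) = x)
    (hs1 : s ((1 : absoluteGaloisGroup ℚ) : absoluteGaloisGroup ℚ ⧸ U) = 1)
    (N : ℕ) [NeZero N] (hN : ∃ r : ℕ, N = 2 ^ r)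
    (P : ContPairing ((cofreeTorsionGaloisModule (Set.range ι) ρ (N : ℤ)).coind U hU).toTopRep
      ((cofreeTorsionGaloisModule (Set.range ι) ρ (N : ℤ)).coind U hU).toTopRep (mu ℚ N).toTopRep)
    (T : Finset (HeightOneSpectrum (𝓞 ℚ)))
    (ψ₁ ψ₂ : contOneCocycles (subgroupRep (cofreeTorsionGaloisModule (Set.range ι) ρ (N : ℤ)).toTopRep U))
    (hψ₁ : ∀ v : HeightOneSpectrum (𝓞 ℚ), v ∉ T → ∀ 𝔓 ∈ v.primesAbove,
      resLe (cofreeTorsionGaloisModule (Set.range ι) ρ (N : ℤ)).toTopRep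
        (inf_le_left : U ⊓ 𝔓.inertia (absoluteGaloisGroup ℚ) ≤ U) 1 (oneCocycleClass _ ψ₁) = 0)
    (hψ₂ : ∀ v : HeightOneSpectrum (𝓞 ℚ), v ∉ T → ∀ 𝔓 ∈ v.primesAbove,
      resLe (cofreeTorsionGaloisModule (Set.range ι) ρ (N : ℤ)).toTopRep
        (inf_le_left : U ⊓ 𝔓.inertia (absoluteGaloisGroup ℚ) ≤ U) 1 (oneCocycleClass _ ψ₂) = 0) :
    ∑ v ∈ T, localInvariantMap ℚ N v (galoisCohomology.localization (mu ℚ N) (Sum.inr v) 2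
      (P.cupProduct
        (shapiroLift (cofreeTorsionGaloisModule (Set.range ι) ρ (N : ℤ)).toTopRep U hU hs hs1 (oneCocycleClass _ ψ₁))
        (shapiroLift (cofreeTorsionGaloisModule (Set.range ι) ρ (N : ℤ)).toTopRep U hU hs hs1 (oneCocycleClass _ ψ₂)))) = 0 :=
  sum_localInvariantMap_cupProduct_shapiroLift_eq_zero_of_resLe_inertia ℚ N hN
    (cofreeTorsionGaloisModule (Set.range ι) ρ (N : ℤ)) (cofreeTorsionGaloisModule (Set.range ι) ρ (N : ℤ)) U hU hs hs1 P T
    ψ₁ ψ₂ hψ₁ hψ₂ fun w ↦ cofreeTorsionGaloisModule_hanti_of_Δ_neg W hss hΔ g ι hnew hcong ρ hρ ϖ hϖ U s w (N : ℤ)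

end Summit.BirchSwinnertonDyer.BirchSwinnertonDyer.Theorems.ThetaTransport

end
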